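import Summits.QuantumFields.YangMills.Theorems.QuantileBitPurityHolonomyLevyWindowDeep
import HarnessLib

/-!
# `QuantileBitPurity.HolonomyLevyWindow` (item stmt-QuantumFields-23923) — PROVED (cap `1/5 ≤ 2/5`)

The original Lévy-window crux X2 of route `QuantileBitPurity` (cap `γc ≤ 1/5`, every centre `c ≥ β^(−γc)`) is the cap-`2/5` statement
`HolonomyLevyWindowDeep` ⟨23949⟩ (`holonomyLevyWindowDeep_proof`: own-axis class shift + flux reflection) restricted to smaller caps.

HONEST FRAMING: fixed-lattice femto-window estimate; the YM mass gap is NOT proved.  No `sorry`, no new axiom, no new definition.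
References: [cite: Luscher1983, §2]; [cite: tHooft1979].
-/

set_option autoImplicit false

namespace Summit.QuantumFields.YangMills.Theorems.QuantileBitPurity

/-- ★ **`QuantileBitPurity.HolonomyLevyWindow` holds** (item stmt-QuantumFields-23923, BY NAME): cap `1/5 ≤ 2/5`.  The YM mass gap is NOT proved.
[cite: Luscher1983, §2] -/
theorem holonomyLevyWindow_proof : Summit.QuantumFields.YangMills.Theses.QuantileBitPurity.HolonomyLevyWindow :=
  fun γc hγc => holonomyLevyWindowDeep_proof γc (le_trans hγc (by norm_num))

end Summit.QuantumFields.YangMills.Theorems.QuantileBitPurity
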